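import Summits.QuantumFields.BalabanUV.Beta.HessKerFourFamily
import Summits.QuantumFields.BalabanUV.Beta.AxialDressingRootedUnits
import Summits.QuantumFields.BalabanUV.Beta.SpineRootedT2

/-!
# `BalabanUV.Beta.HessKerRootedWall` — the road-A2 END over the ROOTED / CENTRED literal `SpineRooted.JsBalAtOf` and over the wall
# candidate v2.22 `SpineRooted.JsBalAn1At hLc hr`, in arbitrary leg units (asymptotic lane asym1, gen 17, v1, part 3 of 3;
# part 1 = `HessKerFourFamily`, part 2 = `AxialDressingRootedUnits`)

HONEST FRAMING (cell contract, verbatim): «discharging `BetaPertH` makes Bałaban's UV stability UNCONDITIONAL — a real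
constructive-QFT result; it is NOT the continuum limit and NOT the Clay problem.»  THIS MODULE applies part 1's DIRECT END to an2 / lit1's
rooted family `SpineRooted.JsBalAtOf hLc hr cE cVH cΛ W Cw δw hδw hW := fun j ↦ AxialDressingRooted.dressAt hr (JsBal0AtOf … j)`
(`SpineRootedStep`, `d = 3`) and to its instance `SpineRooted.JsBalAn1At hLc hr cE cVH cΛ cE₂ cB T` (`SpineRootedT2`; the wall candidate
v2.22 of the cell journal); it formalises NO statement printed in Bałaban's papers, cites none as a hypothesis, mints no `Prop` fact,
instantiates NO binder of the wall at a value (RULING (R18-3): the root offset `r`, the colour weights, the position table `T`, the tables,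
their localisation data, the unit sequences and every constant stay UNIVERSALLY BOUND) and DISCHARGES NOTHING of it.  NOT summit progress.

ABSOLUTE RULE (cell, verbatim): «No internally-minted statement may enter as a cited fact. Every hypothesis is either
kernel-proved in this package or a verbatim quotation of a PUBLISHED theorem with page reference. The manuscript(s) under
audit are NOT citable for their own disputed steps — they are the thing under adjudication; programme-internal
(2001/route/tribunal) claims are never citable.»  The data binders below are HYPOTHESIS SHAPES with free constants, never asserted; nothing here
says that Bałaban's objects satisfy them in any units (located, NOT in print: O-asym1-1).

PLACEMENT.  Cell result under the registered topic `Summits/QuantumFields/BalabanUV/Beta/` (β-lead (R34-2); ≤ 400 lines; theorems only).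

WHY THIS LEAF.  The wall's v2.22 candidate is `D1Drift Lc (SpineRooted.JsBalAn1At hLc hr cE cVH cΛ cE₂ cB T) N μ ν`, and `JsBalAn1At hLc hr …`
is, by `rfl` (`JsBalAn1At_eq`, `JsBalT2AtOf_eq`, `JsBalW2AtOf`, `WbalT2AtOf`), the instance of `JsBalAtOf hLc hr cE cVH cΛ W Cw δw hδw hW` at
an1 / an2's rooted recursive tables `W♮ j := WbalAtOf 3 Lc (toSite r) cE cVH cΛ (T2AtOf 3 Lc (toSite r) cE cVH cΛ cE₂ cB T (vh₂SAt (toSite r) Lc)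
(mixFFAt (toSite r) Lc)) (mixFFAt (toSite r) Lc) j` (= `WbalT2AtOf … j` at an1's rooted border tables) with their packaged
localisation data (`CwAtOf`, `δwAtOf`, `δwAtOf_pos`, `WbalAtOf_loc₂` at `T2AtOf_loc …`) — §4.  `JsBalAtOf` is dressed by the ROOTED comb
`dressAt hr` (window operator `Πᵀ_ρ = coProjAt (toSite r) Lc` on the stencil bond slot and on both field legs of every stencil value and
every table), not by the corner dressing of `BalabanStepJetsSucc.JsBalOf`; so the lane's ENDs over `JsBalOf` (`HessKerDressedUnitsWall`,
`HessKerDressedStep`) do not apply to it.  Part 1's DIRECT END (`HessKerFourFamily.d1Drift_iff_of_lim_four` at `TbalOf_apply_unit`) needs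
rows on the jet data's OWN rescaled stencils and tables; part 2 moves such rows from the UNDRESSED rescaled families through `dressAt`
(additivity, commutation with the leg units, an2's in-tree transports at the SAME rate).  §3 is the END over `JsBalAtOf`, §4 over v2.22.

PRESENTATIONS.  The undressed rooted stencils `(JsBal0AtOf hLc hr cE cVH cΛ W Cw δw hδw hW j).S` (member `0`: `S0At 3 Lc (toSite r) …`;
member `j+1`: `SstepAt 3 Lc (toSite r) … (j+1)`) do NOT depend on the table data (`JsBal0AtOf_S_indep`); the ENDs take the stencil rows on
ANY presentation `S♭ : ℕ → …` of them (`hS♭ : ∀ j, (JsBal0AtOf … j).S = S♭ j`, e.g. `hS♭ := fun _ ↦ rfl`), and §4 the table rows on any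
presentation `W♭` of `W♮` (`hW♭`), so that suppliers state their rows on the closed forms they actually estimate.

CONTENT (no `def`, no `Prop`; every constant explicit).
* §3 `d = 3`, any in-block root `r`, any tables `W`: `JsBal0AtOf_S_indep`, `JsBalAtOf_S`, `JsBalAtOf_W`, **`TbalOf_JsBalAtOf_unit`** (the
  wall's member over `JsBalAtOf` in any units as a three-family form on the dressed RESCALED families), **`d1Drift_JsBalAtOf_iff_of_lim_unit`**
  (named limits of the undressed rescaled families), **`d1Drift_JsBalAtOf_iff_of_cauchy_unit`** — binder list = that of
  `HessKerDressedUnitsWall.d1Drift_JsBalOf_iff_of_cauchy_unit` with the stencil rows on a presentation `S♭` of `(JsBal0AtOf hLc hr … j).S`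
  (K-slot rows on `D_j K_j D_j` UNCHANGED, so lane G-an2-4's currencies `GAN24.CombesThomas.UnitDecayK` / `SupRateK` / `CauchyDecayK` plug in by
  the same adapter terms `decaysKFamily_unitK_of_unitDecayK`, `decaysKAll_unitK_of_le (cauchyDecayK_of_supRateK …)`),
  `d1Drift_JsBalAtOf_of_cauchy_eq_unit` ((⇐)).
* §4 v2.22: **`JsBalAn1At_eq_JsBalAtOf`** (`rfl`), **`d1Drift_JsBalAn1At_iff_of_cauchy_unit`**, `d1Drift_JsBalAn1At_of_cauchy_eq_unit`.
  The scalar forms with `κ` explicit (`GeomRate` / `AllScalesSeq`, input of `HessKerDressedCauchy.pos_of_ge`) are part 1's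
  `geomRate_secondMoment_TbalOf_four_lim` / `allScalesSeq_secondMoment_TbalOf_four_lim` at `hT := TbalOf_JsBalAtOf_unit` with part 2's
  transports (not restated).
WHAT IS NOT HERE: any row for Bałaban's objects in any units; the identification of the limit second moment with `stepBal N Lc` (O-asym1-7);
`k₀`; `betaPertH_holds`.  NOT continuum, NOT Clay.
-/

open Finset Filter Topology
open scoped BigOperators
open Literature.MathematicalPhysics.QuantumFieldTheory.Balaban1983to89
open Literature.MathematicalPhysics.QuantumFieldTheory.Balaban1983to89.Beta
open ExpKernelCalculus (MKer Decays BiLoc VertexFamily₂ hessKer)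
open AffineAveraging (Form1 box toSite)
open OneStepResolventKernel (Fib LocStencil JetData)
open OneStepKernelFamily (vertexOfK KInvStep TbalOf D1Drift)
open HessKerDressedLimit (limMKerOf limStOf limTabOf decays_limMKerOf decays_sub_limMKerOf locStencil_limStOf locStencil_sub_limStOf
  vertexFamily₂_limTabOf vertexFamily₂_sub_limTabOf)
open Summit.QuantumFields.BalabanUV.Beta.HessKerDressedUnits
open Summit.QuantumFields.BalabanUV.Beta.HessKerFourFamily (TbalOf_apply_unit d1Drift_iff_of_lim_four)
open Summit.QuantumFields.BalabanUV.Beta.AxialDressingRooted (dressKAt coProjAtK dressAt dressAt_S dressAt_W)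
open Summit.QuantumFields.BalabanUV.Beta.AxialDressingRootedUnits (unitS_dressS unitW_dressW locStencil_dressS locStencil_dressS_rate
  vertexFamily₂_dressW vertexFamily₂_dressW_rate)
open Summit.QuantumFields.BalabanUV.Beta.SpineRooted (JsBal0AtOf JsBalAtOf JsBalAtOf_apply JsBal0AtOf_W JsBal0AtOf_S_zero JsBal0AtOf_S_succ
  JsBalAn1At WbalAtOf T2AtOf T2AtOf_loc CwAtOf δwAtOf δwAtOf_pos WbalAtOf_loc₂)
open AveragingMixedJetTables (vh₂SAt mixFFAt)
open Summit.QuantumFields.BalabanUV.Beta.MixedJetTablesPlug (hB_an1 hmix_an1)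

namespace Summit.QuantumFields.BalabanUV.Beta.HessKerRootedWall

/-! ## §3 Dimension four: the END over the rooted literal `SpineRooted.JsBalAtOf`, any in-block root, any leg units -/

section End

variable {Lc : ℕ} [NeZero Lc] (hLc : 1 ≤ Lc) {r : Fin (3 + 1) → ℕ} (hr : r ∈ box (3 + 1) Lc) (cE cVH cΛ : ℝ)
  (W : ℕ → Fin (3 + 1) → (Fin (3 + 1) → ℤ) → Fin (3 + 1) → (Fin (3 + 1) → ℤ) → MKer (3 + 1) (Fib 3))
  (Cw' δw : ℕ → ℝ) (hδw : ∀ j, 0 < δw j) (hW' : ∀ j, VertexFamily₂ (W j) Lc (Cw' j) (δw j))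
  (Sfl : ℕ → Fin (3 + 1) → (Fin (3 + 1) → ℤ) → MKer (3 + 1) (Fib 3)) (sf sm : ℕ → ℝ)
  {Kinf : MKer (3 + 1) (Fib 3)} {Sinf : Fin (3 + 1) → (Fin (3 + 1) → ℤ) → MKer (3 + 1) (Fib 3)}
  {Winf : Fin (3 + 1) → (Fin (3 + 1) → ℤ) → Fin (3 + 1) → (Fin (3 + 1) → ℤ) → MKer (3 + 1) (Fib 3)}
  {R C cK δK Cs cS δS Cw cW δW θ : ℝ}

/-- [folklore] **THE UNDRESSED ROOTED STENCILS DO NOT DEPEND ON THE TABLE DATA**: member `0` is `S0At …`, member `j+1` is `SstepAt … (j+1)`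
(`JsBal0AtOf_S_zero`, `JsBal0AtOf_S_succ`), whatever `(W, Cw, δw, hδw, hW)`. -/
theorem JsBal0AtOf_S_indep
    {W₁ : ℕ → Fin (3 + 1) → (Fin (3 + 1) → ℤ) → Fin (3 + 1) → (Fin (3 + 1) → ℤ) → MKer (3 + 1) (Fib 3)} {Cw₁ δw₁ : ℕ → ℝ}
    {hδw₁ : ∀ j, 0 < δw₁ j} {hW₁ : ∀ j, VertexFamily₂ (W₁ j) Lc (Cw₁ j) (δw₁ j)}
    {W₂ : ℕ → Fin (3 + 1) → (Fin (3 + 1) → ℤ) → Fin (3 + 1) → (Fin (3 + 1) → ℤ) → MKer (3 + 1) (Fib 3)} {Cw₂ δw₂ : ℕ → ℝ}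
    {hδw₂ : ∀ j, 0 < δw₂ j} {hW₂ : ∀ j, VertexFamily₂ (W₂ j) Lc (Cw₂ j) (δw₂ j)} (j : ℕ) :
    (JsBal0AtOf hLc hr cE cVH cΛ W₁ Cw₁ δw₁ hδw₁ hW₁ j).S = (JsBal0AtOf hLc hr cE cVH cΛ W₂ Cw₂ δw₂ hδw₂ hW₂ j).S := by
  cases j with
  | zero => rw [JsBal0AtOf_S_zero, JsBal0AtOf_S_zero]
  | succ j => rw [JsBal0AtOf_S_succ, JsBal0AtOf_S_succ]

/-- [folklore] The stencil family of the rooted member: `𝔇_ρ` of the undressed one (`JsBalAtOf_apply`, `dressAt_S`; `rfl`). -/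
theorem JsBalAtOf_S (j : ℕ) :
    (JsBalAtOf hLc hr cE cVH cΛ W Cw' δw hδw hW' j).S =
      fun κ u => dressKAt (toSite r) Lc (coProjAtK (toSite r) Lc (JsBal0AtOf hLc hr cE cVH cΛ W Cw' δw hδw hW' j).S κ u) := rfl

/-- [folklore] The second-order tables of the rooted member: `𝔇_ρ (W j)` (`JsBalAtOf_apply`, `dressAt_W`, `JsBal0AtOf_W`). -/
theorem JsBalAtOf_W (j : ℕ) :
    (JsBalAtOf hLc hr cE cVH cΛ W Cw' δw hδw hW' j).W = fun μ y ν y' => dressKAt (toSite r) Lc (W j μ y ν y') := by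
  funext μ y ν y'
  rw [JsBalAtOf_apply, dressAt_W, JsBal0AtOf_W]

/-- [folklore] **THE WALL'S MEMBER OVER THE ROOTED LITERAL, IN ANY LEG UNITS, AS A THREE-FAMILY FORM**: for nonzero `s_f j, s_m j` and any
presentation `S♭` of the undressed stencils,
`TbalOf Lc (JsBalAtOf …) j = hessKer (D_j K_j D_j) (vertexOfK (D_j K_j D_j) Lc (𝔇_ρ (unitS_j (S♭ j)))) (𝔇_ρ (unitW_j (W j)))`
(part 1's `TbalOf_apply_unit` + part 2's `unitS_dressS`, `unitW_dressW`). -/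
theorem TbalOf_JsBalAtOf_unit (hSfl : ∀ j, (JsBal0AtOf hLc hr cE cVH cΛ W Cw' δw hδw hW' j).S = Sfl j)
    (hsf : ∀ j, sf j ≠ 0) (hsm : ∀ j, sm j ≠ 0) (j : ℕ) :
    TbalOf Lc (JsBalAtOf hLc hr cE cVH cΛ W Cw' δw hδw hW') j =
      hessKer (unitK (sf j) (sm j) (KInvStep (d := 3) Lc j))
        (vertexOfK (unitK (sf j) (sm j) (KInvStep (d := 3) Lc j)) Lc fun κ u => dressKAt (toSite r) Lc
          (coProjAtK (toSite r) Lc (unitS (sf j) (sm j) (Sfl j)) κ u))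
        fun μ y ν y' => dressKAt (toSite r) Lc (unitW (sf j) (sm j) (W j) μ y ν y') := by
  rw [TbalOf_apply_unit _ sf sm hsf hsm j, JsBalAtOf_S, JsBalAtOf_W, unitS_dressS, unitW_dressW, hSfl j]

/-- [folklore] **THE WALL OVER THE ROOTED LITERAL ⟺ THE EXPLICIT IDENTIFICATION, LIMIT CURRENCY, ANY UNITS**: `j`-uniform pointwise rows
and deviations with rate `θ` of the RESCALED RESOLVENTS `D_j K_j D_j`, the UNDRESSED RESCALED ROOTED STENCILS `unitS_j (S♭ j)` (any
presentation `S♭`, `hS♭`) and the RESCALED TABLES `unitW_j (W j)` against named limits `(K∞, S∞, W∞)`, and `0 ≤ θ < 1` ⟹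
`D1Drift Lc (JsBalAtOf …) N μ ν ↔ secondMoment (hessKer K∞ (vertexOfK K∞ Lc (𝔇_ρ S∞)) (𝔇_ρ W∞)) μ ν = stepBal N Lc`.  Discharges NOTHING. -/
theorem d1Drift_JsBalAtOf_iff_of_lim_unit (hSfl : ∀ j, (JsBal0AtOf hLc hr cE cVH cΛ W Cw' δw hδw hW' j).S = Sfl j)
    (hsf : ∀ j, sf j ≠ 0) (hsm : ∀ j, sm j ≠ 0)
    (hK : ∀ j, Decays (unitK (sf j) (sm j) (KInvStep (d := 3) Lc j)) C δK) (hKinf : Decays Kinf C δK)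
    (hKrate : ∀ j, Decays (unitK (sf j) (sm j) (KInvStep (d := 3) Lc j) - Kinf) (cK * θ ^ j) δK)
    (hS : ∀ j, LocStencil (unitS (sf j) (sm j) (Sfl j)) Cs δS) (hSinf : LocStencil Sinf Cs δS)
    (hSrate : ∀ j, LocStencil (unitS (sf j) (sm j) (Sfl j) - Sinf) (cS * θ ^ j) δS)
    (hW : ∀ j, VertexFamily₂ (unitW (sf j) (sm j) (W j)) Lc Cw δW) (hWinf : VertexFamily₂ Winf Lc Cw δW)
    (hWrate : ∀ j, VertexFamily₂ (unitW (sf j) (sm j) (W j) - Winf) Lc (cW * θ ^ j) δW)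
    (hR : 0 < R) (hRK : R < δK) (hRS : R / 2 < δS) (hRW : R < δW) (hθ0 : 0 ≤ θ) (hθ1 : θ < 1) (μ ν : Fin 4) (N : ℝ) :
    D1Drift Lc (JsBalAtOf hLc hr cE cVH cΛ W Cw' δw hδw hW') N μ ν ↔
      B12Beta.secondMoment (hessKer Kinf
        (vertexOfK Kinf Lc fun κ u => dressKAt (toSite r) Lc (coProjAtK (toSite r) Lc Sinf κ u))
        fun μ y ν y' => dressKAt (toSite r) Lc (Winf μ y ν y')) μ ν = B12Normalization.stepBal N Lc := by
  have hδS : 0 ≤ δS := by linarith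
  have hδW : 0 ≤ δW := by linarith
  exact d1Drift_iff_of_lim_four (JsBalAtOf hLc hr cE cVH cΛ W Cw' δw hδw hW')
    (A := fun j => unitK (sf j) (sm j) (KInvStep (d := 3) Lc j)) (K := fun j => unitK (sf j) (sm j) (KInvStep (d := 3) Lc j))
    (S := fun j κ u => dressKAt (toSite r) Lc (coProjAtK (toSite r) Lc (unitS (sf j) (sm j) (Sfl j)) κ u))
    (W := fun j μ y ν y' => dressKAt (toSite r) Lc (unitW (sf j) (sm j) (W j) μ y ν y')) (Ainf := Kinf) (Kinf := Kinf)
    (Sinf := fun κ u => dressKAt (toSite r) Lc (coProjAtK (toSite r) Lc Sinf κ u))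
    (Winf := fun μ y ν y' => dressKAt (toSite r) Lc (Winf μ y ν y'))
    (TbalOf_JsBalAtOf_unit hLc hr cE cVH cΛ W Cw' δw hδw hW' Sfl sf sm hSfl hsf hsm) hK hKinf hKrate hK hKinf hKrate
    (fun j => locStencil_dressS hLc hr (hS j) hδS) (locStencil_dressS hLc hr hSinf hδS)
    (fun j => locStencil_dressS_rate hLc hr (hSrate j) hδS)
    (fun j => vertexFamily₂_dressW hLc hr (hW j) hδW) (vertexFamily₂_dressW hLc hr hWinf hδW)
    (fun j => vertexFamily₂_dressW_rate hLc hr (hWrate j) hδW) hR hRK hRS hRW hθ0 hθ1 μ ν N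

/-- [folklore] **THE WALL OVER THE ROOTED LITERAL ⟺ THE EXPLICIT IDENTIFICATION AT THE CONSTRUCTED LIMITS, CAUCHY CURRENCY, ANY UNITS** —
the binder list of `HessKerDressedUnitsWall.d1Drift_JsBalOf_iff_of_cauchy_unit` with the stencil rows on a presentation `S♭` of the
undressed rooted stencils `(JsBal0AtOf hLc hr … j).S` (`hS♭`): `j`-uniform rows + ALL-SCALES deviations of `D_j K_j D_j`, of `unitS_j (S♭ j)`,
of `unitW_j (W j)`, and `0 ≤ θ < 1` ⟹
`D1Drift Lc (JsBalAtOf …) N μ ν ↔ secondMoment (hessKer K∞ (vertexOfK K∞ Lc (𝔇_ρ S∞)) (𝔇_ρ W∞)) μ ν = stepBal N Lc` at `K∞ = limMKerOf (D K D)`,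
`S∞ = limStOf (unitS S♭)`, `W∞ = limTabOf (unitW W)` (`HessKerDressedLimit` §1).  Road A2's second half over the rooted family; NOT proved here. -/
theorem d1Drift_JsBalAtOf_iff_of_cauchy_unit (hSfl : ∀ j, (JsBal0AtOf hLc hr cE cVH cΛ W Cw' δw hδw hW' j).S = Sfl j)
    (hsf : ∀ j, sf j ≠ 0) (hsm : ∀ j, sm j ≠ 0)
    (hK : ∀ j, Decays (unitK (sf j) (sm j) (KInvStep (d := 3) Lc j)) C δK)
    (hKall : ∀ k j, Decays (unitK (sf (k + j)) (sm (k + j)) (KInvStep (d := 3) Lc (k + j)) -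
      unitK (sf k) (sm k) (KInvStep (d := 3) Lc k)) (cK * θ ^ k) δK)
    (hS : ∀ j, LocStencil (unitS (sf j) (sm j) (Sfl j)) Cs δS)
    (hSall : ∀ k j, LocStencil (unitS (sf (k + j)) (sm (k + j)) (Sfl (k + j)) - unitS (sf k) (sm k) (Sfl k)) (cS * θ ^ k) δS)
    (hW : ∀ j, VertexFamily₂ (unitW (sf j) (sm j) (W j)) Lc Cw δW)
    (hWall : ∀ k j, VertexFamily₂ (unitW (sf (k + j)) (sm (k + j)) (W (k + j)) - unitW (sf k) (sm k) (W k)) Lc (cW * θ ^ k) δW)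
    (hR : 0 < R) (hRK : R < δK) (hRS : R / 2 < δS) (hRW : R < δW) (hθ0 : 0 ≤ θ) (hθ1 : θ < 1) (μ ν : Fin 4) (N : ℝ) :
    D1Drift Lc (JsBalAtOf hLc hr cE cVH cΛ W Cw' δw hδw hW') N μ ν ↔
      B12Beta.secondMoment (hessKer (limMKerOf fun j => unitK (sf j) (sm j) (KInvStep (d := 3) Lc j))
        (vertexOfK (limMKerOf fun j => unitK (sf j) (sm j) (KInvStep (d := 3) Lc j)) Lc fun κ u => dressKAt (toSite r) Lc
          (coProjAtK (toSite r) Lc (limStOf fun j => unitS (sf j) (sm j) (Sfl j)) κ u))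
        fun μ y ν y' => dressKAt (toSite r) Lc (limTabOf (fun j => unitW (sf j) (sm j) (W j)) μ y ν y')) μ ν =
        B12Normalization.stepBal N Lc :=
  d1Drift_JsBalAtOf_iff_of_lim_unit hLc hr cE cVH cΛ W Cw' δw hδw hW' Sfl sf sm
    (Kinf := limMKerOf fun j => unitK (sf j) (sm j) (KInvStep (d := 3) Lc j)) (Sinf := limStOf fun j => unitS (sf j) (sm j) (Sfl j))
    (Winf := limTabOf fun j => unitW (sf j) (sm j) (W j)) hSfl hsf hsm hK (decays_limMKerOf hK hKall hθ1) (decays_sub_limMKerOf hKall hθ1)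
    hS (locStencil_limStOf hS hSall hθ1) (locStencil_sub_limStOf hSall hθ1) hW (vertexFamily₂_limTabOf hW hWall hθ1)
    (vertexFamily₂_sub_limTabOf hWall hθ1) hR hRK hRS hRW hθ0 hθ1 μ ν N

/-- [folklore] **THE WALL OVER THE ROOTED LITERAL FROM THE ROWS + THE EXPLICIT IDENTIFICATION AT THE CONSTRUCTED LIMITS** (the (⇐) direction). -/
theorem d1Drift_JsBalAtOf_of_cauchy_eq_unit (hSfl : ∀ j, (JsBal0AtOf hLc hr cE cVH cΛ W Cw' δw hδw hW' j).S = Sfl j)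
    (hsf : ∀ j, sf j ≠ 0) (hsm : ∀ j, sm j ≠ 0)
    (hK : ∀ j, Decays (unitK (sf j) (sm j) (KInvStep (d := 3) Lc j)) C δK)
    (hKall : ∀ k j, Decays (unitK (sf (k + j)) (sm (k + j)) (KInvStep (d := 3) Lc (k + j)) -
      unitK (sf k) (sm k) (KInvStep (d := 3) Lc k)) (cK * θ ^ k) δK)
    (hS : ∀ j, LocStencil (unitS (sf j) (sm j) (Sfl j)) Cs δS)
    (hSall : ∀ k j, LocStencil (unitS (sf (k + j)) (sm (k + j)) (Sfl (k + j)) - unitS (sf k) (sm k) (Sfl k)) (cS * θ ^ k) δS)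
    (hW : ∀ j, VertexFamily₂ (unitW (sf j) (sm j) (W j)) Lc Cw δW)
    (hWall : ∀ k j, VertexFamily₂ (unitW (sf (k + j)) (sm (k + j)) (W (k + j)) - unitW (sf k) (sm k) (W k)) Lc (cW * θ ^ k) δW)
    (hR : 0 < R) (hRK : R < δK) (hRS : R / 2 < δS) (hRW : R < δW) (hθ0 : 0 ≤ θ) (hθ1 : θ < 1) (μ ν : Fin 4) {N : ℝ}
    (hEq : B12Beta.secondMoment (hessKer (limMKerOf fun j => unitK (sf j) (sm j) (KInvStep (d := 3) Lc j))
        (vertexOfK (limMKerOf fun j => unitK (sf j) (sm j) (KInvStep (d := 3) Lc j)) Lc fun κ u => dressKAt (toSite r) Lc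
          (coProjAtK (toSite r) Lc (limStOf fun j => unitS (sf j) (sm j) (Sfl j)) κ u))
        fun μ y ν y' => dressKAt (toSite r) Lc (limTabOf (fun j => unitW (sf j) (sm j) (W j)) μ y ν y')) μ ν =
        B12Normalization.stepBal N Lc) :
    D1Drift Lc (JsBalAtOf hLc hr cE cVH cΛ W Cw' δw hδw hW') N μ ν :=
  (d1Drift_JsBalAtOf_iff_of_cauchy_unit hLc hr cE cVH cΛ W Cw' δw hδw hW' Sfl sf sm hSfl hsf hsm hK hKall hS hSall hW hWall hR hRK hRS hRW
    hθ0 hθ1 μ ν N).2 hEq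

end End

/-! ## §4 The wall candidate v2.22: `SpineRooted.JsBalAn1At hLc hr` is `JsBalAtOf` at an1 / an2's rooted recursive tables -/

section WallV222

variable {Lc : ℕ} [NeZero Lc] (hLc : 1 ≤ Lc) {r : Fin (3 + 1) → ℕ} (hr : r ∈ box (3 + 1) Lc) (cE cVH cΛ cE₂ cB : ℝ)
  (T : Fin 4 → Fin 4 → Fin 4 → Fin 4 → ℝ) (Sfl : ℕ → Fin (3 + 1) → (Fin (3 + 1) → ℤ) → MKer (3 + 1) (Fib 3))
  (Wfl : ℕ → Fin (3 + 1) → (Fin (3 + 1) → ℤ) → Fin (3 + 1) → (Fin (3 + 1) → ℤ) → MKer (3 + 1) (Fib 3)) (sf sm : ℕ → ℝ)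
  {R C cK δK Cs cS δS Cw cW δW θ : ℝ}

/-- [folklore] **v2.22's FAMILY IS AN INSTANCE OF `JsBalAtOf`** (`JsBalAn1At_eq`, `JsBalT2AtOf_eq`, `JsBalW2AtOf`, `WbalT2AtOf`; `rfl`): the tables
are `W♮ j := WbalAtOf 3 Lc (toSite r) cE cVH cΛ (T2AtOf 3 Lc (toSite r) … (vh₂SAt (toSite r) Lc) (mixFFAt (toSite r) Lc)) (mixFFAt (toSite r) Lc) j`
(an1's rooted border tables `vh₂SAt`, `mixFFAt` plugged into an2's recursive `T2AtOf`), the localisation data an2's packaged `CwAtOf` / `δwAtOf` /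
`δwAtOf_pos` / `WbalAtOf_loc₂` at `T2AtOf_loc … (hB_an1 hLc hr) (hmix_an1 hLc hr)`. -/
theorem JsBalAn1At_eq_JsBalAtOf :
    JsBalAn1At hLc hr cE cVH cΛ cE₂ cB T =
      JsBalAtOf hLc hr cE cVH cΛ (WbalAtOf 3 Lc (toSite r) cE cVH cΛ
          (T2AtOf 3 Lc (toSite r) cE cVH cΛ cE₂ cB T (vh₂SAt (toSite r) Lc) (mixFFAt (toSite r) Lc)) (mixFFAt (toSite r) Lc))
        (CwAtOf hLc hr cE cVH cΛ (T2AtOf_loc hLc hr cE cVH cΛ cE₂ cB T (hB_an1 hLc hr) (hmix_an1 hLc hr)) (hmix_an1 hLc hr))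
        (δwAtOf hLc hr cE cVH cΛ (T2AtOf_loc hLc hr cE cVH cΛ cE₂ cB T (hB_an1 hLc hr) (hmix_an1 hLc hr)) (hmix_an1 hLc hr))
        (δwAtOf_pos hLc hr cE cVH cΛ (T2AtOf_loc hLc hr cE cVH cΛ cE₂ cB T (hB_an1 hLc hr) (hmix_an1 hLc hr)) (hmix_an1 hLc hr))
        (WbalAtOf_loc₂ hLc hr cE cVH cΛ (T2AtOf_loc hLc hr cE cVH cΛ cE₂ cB T (hB_an1 hLc hr) (hmix_an1 hLc hr)) (hmix_an1 hLc hr)) :=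
  rfl

/-- [folklore] **THE WALL CANDIDATE v2.22 ⟺ THE EXPLICIT IDENTIFICATION AT THE CONSTRUCTED LIMITS, CAUCHY CURRENCY, ANY UNITS** — §3's END at
v2.22's instance, for ANY presentations `S♭` of the undressed rooted stencils (`hS♭`, stated against ANY table data: they do not enter,
`JsBal0AtOf_S_indep`) and `W♭` of the tables `W♮` (`hW♭`): `j`-uniform rows + ALL-SCALES deviations with rate `θ` of `D_j K_j D_j` (G-an2-4's
currencies), of `unitS_j (S♭ j)`, of `unitW_j (W♭ j)`, and `0 ≤ θ < 1` ⟹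
`D1Drift Lc (SpineRooted.JsBalAn1At hLc hr cE cVH cΛ cE₂ cB T) N μ ν ↔ secondMoment (hessKer K∞ (vertexOfK K∞ Lc (𝔇_ρ S∞)) (𝔇_ρ W∞)) μ ν = stepBal N Lc`
at `K∞ = limMKerOf (D K D)`, `S∞ = limStOf (unitS S♭)`, `W∞ = limTabOf (unitW W♭)`.  Road A2's second half FOR THE WALL CANDIDATE; it instantiates
no binder at a value and discharges NOTHING (the rows for Bałaban's objects are O-asym1-1 / G-an2-4; the identification is O-asym1-7). -/
theorem d1Drift_JsBalAn1At_iff_of_cauchy_unit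
    {W₀ : ℕ → Fin (3 + 1) → (Fin (3 + 1) → ℤ) → Fin (3 + 1) → (Fin (3 + 1) → ℤ) → MKer (3 + 1) (Fib 3)} {Cw₀ δw₀ : ℕ → ℝ}
    {hδw₀ : ∀ j, 0 < δw₀ j} {hW₀ : ∀ j, VertexFamily₂ (W₀ j) Lc (Cw₀ j) (δw₀ j)}
    (hSfl : ∀ j, (JsBal0AtOf hLc hr cE cVH cΛ W₀ Cw₀ δw₀ hδw₀ hW₀ j).S = Sfl j)
    (hWfl : ∀ j, WbalAtOf 3 Lc (toSite r) cE cVH cΛ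
      (T2AtOf 3 Lc (toSite r) cE cVH cΛ cE₂ cB T (vh₂SAt (toSite r) Lc) (mixFFAt (toSite r) Lc)) (mixFFAt (toSite r) Lc) j = Wfl j)
    (hsf : ∀ j, sf j ≠ 0) (hsm : ∀ j, sm j ≠ 0)
    (hK : ∀ j, Decays (unitK (sf j) (sm j) (KInvStep (d := 3) Lc j)) C δK)
    (hKall : ∀ k j, Decays (unitK (sf (k + j)) (sm (k + j)) (KInvStep (d := 3) Lc (k + j)) -
      unitK (sf k) (sm k) (KInvStep (d := 3) Lc k)) (cK * θ ^ k) δK)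
    (hS : ∀ j, LocStencil (unitS (sf j) (sm j) (Sfl j)) Cs δS)
    (hSall : ∀ k j, LocStencil (unitS (sf (k + j)) (sm (k + j)) (Sfl (k + j)) - unitS (sf k) (sm k) (Sfl k)) (cS * θ ^ k) δS)
    (hW : ∀ j, VertexFamily₂ (unitW (sf j) (sm j) (Wfl j)) Lc Cw δW)
    (hWall : ∀ k j, VertexFamily₂ (unitW (sf (k + j)) (sm (k + j)) (Wfl (k + j)) - unitW (sf k) (sm k) (Wfl k)) Lc (cW * θ ^ k) δW)
    (hR : 0 < R) (hRK : R < δK) (hRS : R / 2 < δS) (hRW : R < δW) (hθ0 : 0 ≤ θ) (hθ1 : θ < 1) (μ ν : Fin 4) (N : ℝ) :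
    D1Drift Lc (JsBalAn1At hLc hr cE cVH cΛ cE₂ cB T) N μ ν ↔
      B12Beta.secondMoment (hessKer (limMKerOf fun j => unitK (sf j) (sm j) (KInvStep (d := 3) Lc j))
        (vertexOfK (limMKerOf fun j => unitK (sf j) (sm j) (KInvStep (d := 3) Lc j)) Lc fun κ u => dressKAt (toSite r) Lc
          (coProjAtK (toSite r) Lc (limStOf fun j => unitS (sf j) (sm j) (Sfl j)) κ u))
        fun μ y ν y' => dressKAt (toSite r) Lc (limTabOf (fun j => unitW (sf j) (sm j) (Wfl j)) μ y ν y')) μ ν =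
        B12Normalization.stepBal N Lc := by
  obtain rfl : WbalAtOf 3 Lc (toSite r) cE cVH cΛ
      (T2AtOf 3 Lc (toSite r) cE cVH cΛ cE₂ cB T (vh₂SAt (toSite r) Lc) (mixFFAt (toSite r) Lc)) (mixFFAt (toSite r) Lc) = Wfl :=
    funext hWfl
  rw [JsBalAn1At_eq_JsBalAtOf]
  refine d1Drift_JsBalAtOf_iff_of_cauchy_unit hLc hr cE cVH cΛ _ _ _ _ _ Sfl sf sm (fun j => ?_) hsf hsm hK hKall hS hSall hW hWall hR hRK
    hRS hRW hθ0 hθ1 μ ν N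
  exact (JsBal0AtOf_S_indep hLc hr cE cVH cΛ j).trans (hSfl j)

/-- [folklore] **THE WALL CANDIDATE v2.22 FROM THE ROWS + THE EXPLICIT IDENTIFICATION AT THE CONSTRUCTED LIMITS** (the (⇐) direction). -/
theorem d1Drift_JsBalAn1At_of_cauchy_eq_unit
    {W₀ : ℕ → Fin (3 + 1) → (Fin (3 + 1) → ℤ) → Fin (3 + 1) → (Fin (3 + 1) → ℤ) → MKer (3 + 1) (Fib 3)} {Cw₀ δw₀ : ℕ → ℝ}
    {hδw₀ : ∀ j, 0 < δw₀ j} {hW₀ : ∀ j, VertexFamily₂ (W₀ j) Lc (Cw₀ j) (δw₀ j)}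
    (hSfl : ∀ j, (JsBal0AtOf hLc hr cE cVH cΛ W₀ Cw₀ δw₀ hδw₀ hW₀ j).S = Sfl j)
    (hWfl : ∀ j, WbalAtOf 3 Lc (toSite r) cE cVH cΛ
      (T2AtOf 3 Lc (toSite r) cE cVH cΛ cE₂ cB T (vh₂SAt (toSite r) Lc) (mixFFAt (toSite r) Lc)) (mixFFAt (toSite r) Lc) j = Wfl j)
    (hsf : ∀ j, sf j ≠ 0) (hsm : ∀ j, sm j ≠ 0)
    (hK : ∀ j, Decays (unitK (sf j) (sm j) (KInvStep (d := 3) Lc j)) C δK)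
    (hKall : ∀ k j, Decays (unitK (sf (k + j)) (sm (k + j)) (KInvStep (d := 3) Lc (k + j)) -
      unitK (sf k) (sm k) (KInvStep (d := 3) Lc k)) (cK * θ ^ k) δK)
    (hS : ∀ j, LocStencil (unitS (sf j) (sm j) (Sfl j)) Cs δS)
    (hSall : ∀ k j, LocStencil (unitS (sf (k + j)) (sm (k + j)) (Sfl (k + j)) - unitS (sf k) (sm k) (Sfl k)) (cS * θ ^ k) δS)
    (hW : ∀ j, VertexFamily₂ (unitW (sf j) (sm j) (Wfl j)) Lc Cw δW)
    (hWall : ∀ k j, VertexFamily₂ (unitW (sf (k + j)) (sm (k + j)) (Wfl (k + j)) - unitW (sf k) (sm k) (Wfl k)) Lc (cW * θ ^ k) δW)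
    (hR : 0 < R) (hRK : R < δK) (hRS : R / 2 < δS) (hRW : R < δW) (hθ0 : 0 ≤ θ) (hθ1 : θ < 1) (μ ν : Fin 4) {N : ℝ}
    (hEq : B12Beta.secondMoment (hessKer (limMKerOf fun j => unitK (sf j) (sm j) (KInvStep (d := 3) Lc j))
        (vertexOfK (limMKerOf fun j => unitK (sf j) (sm j) (KInvStep (d := 3) Lc j)) Lc fun κ u => dressKAt (toSite r) Lc
          (coProjAtK (toSite r) Lc (limStOf fun j => unitS (sf j) (sm j) (Sfl j)) κ u))
        fun μ y ν y' => dressKAt (toSite r) Lc (limTabOf (fun j => unitW (sf j) (sm j) (Wfl j)) μ y ν y')) μ ν =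
        B12Normalization.stepBal N Lc) :
    D1Drift Lc (JsBalAn1At hLc hr cE cVH cΛ cE₂ cB T) N μ ν :=
  (d1Drift_JsBalAn1At_iff_of_cauchy_unit hLc hr cE cVH cΛ cE₂ cB T Sfl Wfl sf sm hSfl hWfl hsf hsm hK hKall hS hSall hW hWall hR hRK hRS hRW
    hθ0 hθ1 μ ν N).2 hEq

end WallV222

end Summit.QuantumFields.BalabanUV.Beta.HessKerRootedWall
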